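import Literature.NumberTheory.LFunctions.TaoLogElliottTheorem23
import Literature.NumberTheory.LFunctions.TaoLogElliottProp21
import Mathlib.MeasureTheory.Integral.IntervalIntegral.Basic
import Mathlib.MeasureTheory.Integral.Bochner.Set
import Mathlib.MeasureTheory.Measure.Lebesgue.Basic
import Mathlib.Analysis.SpecialFunctions.Log.Monotone
import HarnessLib

/-!
# Tao's log-averaged Elliott theorem: Proposition 2.4 from Matomäki–Radziwiłł–Tao

Below the named fact `Literature.NumberTheory.LFunctions.tao_log_averaged_elliott_two` (Tao, Forum Math. Pi 4 (2016) e8,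
Theorem 1.3): `TaoLogElliottTheorem23.lean` splits Theorem 2.3 into Proposition 2.4
(`Literature.NumberTheory.LFunctions.Tao2016_prop24`, the only use of the non-pretentiousness hypothesis) and the core argument
(`Literature.NumberTheory.LFunctions.Tao2016_theorem23_core`).  Here Proposition 2.4 is PROVED from the named fact recording
Matomäki–Radziwiłł–Tao 2015, Theorem 1.7 (`Literature.NumberTheory.LFunctions.MatomakiRadziwillTao2015_theorem17`), following
the printed proof ("Applying [MRT] (with `W := log⁵ H`) … Averaging this estimate for `X` between
`x/2ω` and `2x`") with the bookkeeping it leaves implicit: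

* `Literature.NumberTheory.LFunctions.Tao2016.sum_norm_shortExpSum_eq_integral` — for integer `H`, on `y ∈ (n, n+1)` the integers
  of `[y, y+H]` are `n+1, …, n+H`, so `∑_{n < N} |∑_{j=1}^H g(n+j) e(jα)| = ∫_0^N |∑_{y ≤ m ≤ y+H}
  g(m) e(αm)| dy` (the MRT integrand is a step function);
* `Literature.NumberTheory.LFunctions.Tao2016.sum_norm_shortExpSum_le` — hence MRT bounds these sums by
  `C₀ (e^{-M/20} + log log H / log H + log^{-1/700} N) H N`, `M = M(g; N, min(log^{1/125} N, log⁵ H))`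
  (`M(g; X, Q)` being the tree's `Literature.NumberTheory.Sieve.nonpretentiousness`), for the arithmetic-function extension
  `toArithmeticFunction g₁` of the completely multiplicative `S¹`-valued `g₁`;
* `Literature.NumberTheory.LFunctions.Tao2016.le_nonpretentiousness`, `pretentiousDistSq_window`, `pretentiousDistSq_at_height` —
  hypothesis (2.7) at height `x` and level `A` gives `M(g₁; N, Q) ≥ A/2` for `Q ≤ log⁵ H ≤ A`,
  `|t| ≤ N ≤ 3x ≤ Ax` and `x^θ ≤ N` (monotonicity of `𝔻²` in the height if `N ≥ x`, and the
  Chebyshev-strength window bound `∑_{N < p ≤ x} 2/p ≤ 16/θ + 16` if `N < x`);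
* `Literature.Tao2016_prop24_of_MRT : MatomakiRadziwillTao2015_theorem17 → Tao2016_prop24` —
  the dyadic decomposition of `(x/ω, x]` above `max(8, x^θ, T)` (`sum_norm_div_high_le`,
  `card_blocks_le` of `TaoLogElliottUnimodular.lean`) and the trivial bound below
  (`sum_inv_low_le`), with `θ = ℓ(max(H₊,16))/64`, `ℓ(H) = log log H / log H`;
* `Literature.NumberTheory.LFunctions.Tao2016_theorem23_of_MRT_core`, `Literature.NumberTheory.LFunctions.tao_log_averaged_elliott_two_of_MRT_core` — assembly
  with `Tao2016_theorem23_of_parts` and the proved §2 reduction `Tao2016_section2_reduction_holds`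
  (`TaoLogElliottProp21.lean`): Theorem 2.3, resp. Theorem 1.3, follow from MRT 2015, Theorem 1.7
  and the core argument `Tao2016_theorem23_core`.

## References
* T. Tao, *The logarithmically averaged Chowla and Elliott conjectures for two-point
  correlations*, Forum Math. Pi 4 (2016), e8; arXiv:1509.05422, Proposition 2.4 and its proof.
* K. Matomäki, M. Radziwiłł, T. Tao, *An averaged form of Chowla's conjecture*, Algebra & Number
  Theory 9 (2015), Theorem 1.7.

## Design choices
* Constants: `C = 48 C₀ + 2` (`C₀ ≥ 1` the MRT constant), `H₀ = 16` (so that `log H > e` and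
  `ℓ` is positive and non-increasing, `Real.log_div_self_antitoneOn`); for given `H₊`,
  `T = max(H₊, 16)`, `ℓ₊ = ℓ(T)`, `θ = ℓ₊/64`, and
  `A₀ = max(3, e^T, log⁵ T, 2048/ℓ₊ + 32, 40/ℓ₊, exp(64 ℓ₊^{-701}), exp(6/ℓ₊))`.
* The normalised short sums `|∑_{j ≤ H} g₁(m+j)e(jα)|/H ∈ [0,1]` are packaged, truncated at
  `m ≤ 2⌊x⌋ + 2`, as the values of an auxiliary arithmetic function so that the dyadic lemma of
  `TaoLogElliottUnimodular.lean` applies verbatim; the truncation keeps the heights `N ≤ 3x` at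
  which (2.7) is invoked.
* The main proof is long; it is elaborated with `maxHeartbeats 800000`.
-/

open Finset Complex MeasureTheory

namespace Literature.NumberTheory.LFunctions

namespace Tao2016

/-! ### From the integral of Matomäki–Radziwiłł–Tao to sums over integers

For integer `H` and `y ∈ (n, n+1)`, the integers of `[y, y + H]` are `n+1, …, n+H`, so the
MRT integrand is constant there and equals `|∑_{j=1}^H g(n+j) e(jα)|`. -/

/-- The MRT integrand at frequency `α` and length `H`: `y ↦ |∑_{y ≤ m ≤ y+H} g(m) e(αm)|`.
[cite: MatomakiRadziwillTao2015, Theorem 1.7] -/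
noncomputable def mrtIntegrand (g : ℕ → ℂ) (H : ℕ) (α : ℝ) (y : ℝ) : ℝ :=
  ‖∑ m ∈ Icc ⌈y⌉₊ ⌊y + (H : ℝ)⌋₊, g m * Complex.exp (2 * Real.pi * Complex.I * (α : ℂ) * (m : ℂ))‖

/-- On `(n, n+1)` the integers of `[y, y+H]` are `n+1, …, n+H`. [folklore] -/
theorem Icc_ceil_floor_eq {n H : ℕ} {y : ℝ} (hy : y ∈ Set.Ioo (n : ℝ) (n + 1)) :
    Icc ⌈y⌉₊ ⌊y + (H : ℝ)⌋₊ = Icc (n + 1) (n + H) := by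
  obtain ⟨h1, h2⟩ := hy
  have hy0 : 0 ≤ y := le_trans (Nat.cast_nonneg n) h1.le
  have hc : ⌈y⌉₊ = n + 1 := by
    rw [Nat.ceil_eq_iff (Nat.succ_ne_zero n), Nat.succ_sub_one]
    push_cast
    exact ⟨h1, h2.le⟩
  have hf : ⌊y + (H : ℝ)⌋₊ = n + H := by
    rw [Nat.floor_eq_iff (by positivity)]
    push_cast
    constructor <;> linarith
  rw [hc, hf]

/-- On `(n, n+1)` the MRT integrand equals `|∑_{j=1}^H g(n+j) e(jα)|`. [folklore] -/
theorem mrtIntegrand_eq_of_mem_Ioo (g : ℕ → ℂ) (H : ℕ) (α : ℝ) {n : ℕ} {y : ℝ}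
    (hy : y ∈ Set.Ioo (n : ℝ) (n + 1)) :
    mrtIntegrand g H α y = ‖shortExpSum g n H α‖ := by
  unfold mrtIntegrand shortExpSum
  rw [Icc_ceil_floor_eq hy, ← Finset.map_add_left_Icc, Finset.sum_map]
  have h : ∀ j : ℕ, g (n + j) * Complex.exp (2 * Real.pi * Complex.I * (α : ℂ) * ((n + j : ℕ) : ℂ))
      = Complex.exp (2 * Real.pi * Complex.I * (α : ℂ) * (n : ℂ))
        * (g (n + j) * Complex.exp (2 * Real.pi * Complex.I * (j : ℂ) * (α : ℂ))) := by
    intro j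
    rw [mul_left_comm, ← Complex.exp_add]
    push_cast
    ring_nf
  simp only [addLeftEmbedding_apply, h, ← Finset.mul_sum, norm_mul]
  rw [Complex.norm_exp]
  simp

/-- The integral of the MRT integrand over `[n, n+1]` is `|∑_{j=1}^H g(n+j) e(jα)|`, and the
integrand is interval integrable there. [folklore] -/
theorem integral_mrtIntegrand_unit (g : ℕ → ℂ) (H : ℕ) (α : ℝ) (n : ℕ) :
    IntervalIntegrable (mrtIntegrand g H α) volume (n : ℝ) ((n : ℝ) + 1) ∧
      ∫ y in (n : ℝ)..((n : ℝ) + 1), mrtIntegrand g H α y = ‖shortExpSum g n H α‖ := by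
  have hle : (n : ℝ) ≤ n + 1 := by linarith
  have hae : (mrtIntegrand g H α) =ᵐ[volume.restrict (Set.Ioc (n : ℝ) (n + 1))]
      fun _ => ‖shortExpSum g n H α‖ := by
    rw [← Measure.restrict_congr_set (Ioo_ae_eq_Ioc (μ := volume) (a := (n : ℝ)) (b := n + 1))]
    rw [Filter.EventuallyEq, ae_restrict_iff' measurableSet_Ioo]
    exact Filter.Eventually.of_forall fun y hy => mrtIntegrand_eq_of_mem_Ioo g H α hy
  have hint : IntegrableOn (mrtIntegrand g H α) (Set.Ioc (n : ℝ) (n + 1)) volume := by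
    refine IntegrableOn.congr_fun_ae ?_ hae.symm
    exact integrableOn_const (by rw [Real.volume_Ioc]; exact ENNReal.ofReal_ne_top)
  refine ⟨?_, ?_⟩
  · rw [intervalIntegrable_iff, Set.uIoc_of_le hle]
    exact hint
  · rw [intervalIntegral.integral_of_le hle, integral_congr_ae hae, setIntegral_const,
      Real.volume_real_Ioc, smul_eq_mul]
    have : max ((n : ℝ) + 1 - n) 0 = 1 := by rw [max_eq_left (by linarith)]; ring
    rw [this, one_mul]

/-- **Sums over integers from the MRT integral**:
`∑_{n < N} |∑_{j=1}^H g(n+j) e(jα)| = ∫_0^N |∑_{y ≤ m ≤ y+H} g(m) e(αm)| dy`. [folklore] -/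
theorem sum_norm_shortExpSum_eq_integral (g : ℕ → ℂ) (H : ℕ) (α : ℝ) (N : ℕ) :
    ∑ n ∈ Finset.range N, ‖shortExpSum g n H α‖
      = ∫ y in (0 : ℝ)..(N : ℝ), mrtIntegrand g H α y := by
  have h := intervalIntegral.sum_integral_adjacent_intervals (f := mrtIntegrand g H α)
    (μ := volume) (a := fun k : ℕ => (k : ℝ)) (n := N)
    (fun k _ => by exact_mod_cast (integral_mrtIntegrand_unit g H α k).1)
  push_cast at h
  rw [← h]
  exact Finset.sum_congr rfl fun n _ => ((integral_mrtIntegrand_unit g H α n).2).symm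

/-! ### The arithmetic-function extension of `g₁` (Mathlib's `toArithmeticFunction`) and the MRT bound for sums over integers -/

/-- Mathlib's `toArithmeticFunction g` (extension of `g : ℕ → ℂ` by `0` at `0`) agrees with `g`
on `n ≠ 0`. [folklore] -/
theorem toArithmeticFunction_apply_ne_zero {g : ℕ → ℂ} {n : ℕ} (hn : n ≠ 0) :
    toArithmeticFunction g n = g n := by
  simp [toArithmeticFunction, hn]

/-- A completely multiplicative `S¹`-valued `g : ℕ → ℂ` (on `n ≥ 1`) has `g 1 = 1`. [folklore] -/
theorem map_one_of_cm {g : ℕ → ℂ} (hcm : ∀ m n : ℕ, 1 ≤ m → 1 ≤ n → g (m * n) = g m * g n)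
    (hS : ∀ n : ℕ, 1 ≤ n → ‖g n‖ = 1) : g 1 = 1 := by
  have h1 := hcm 1 1 le_rfl le_rfl
  rw [mul_one] at h1
  have hne : g 1 ≠ 0 := by
    intro h0; have := hS 1 le_rfl; rw [h0, norm_zero] at this; exact zero_ne_one this
  have : g 1 * (g 1 - 1) = 0 := by rw [mul_sub, mul_one, ← h1, sub_self]
  rcases mul_eq_zero.mp this with h | h
  · exact absurd h hne
  · exact sub_eq_zero.mp h

/-- The extension of a completely multiplicative `S¹`-valued function is multiplicative.
[folklore] -/
theorem isMultiplicative_toArithmeticFunction {g : ℕ → ℂ}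
    (hcm : ∀ m n : ℕ, 1 ≤ m → 1 ≤ n → g (m * n) = g m * g n)
    (hS : ∀ n : ℕ, 1 ≤ n → ‖g n‖ = 1) : (toArithmeticFunction g).IsMultiplicative := by
  refine ⟨by rw [toArithmeticFunction_apply_ne_zero one_ne_zero, map_one_of_cm hcm hS], fun {m n} hmn => ?_⟩
  rcases Nat.eq_zero_or_pos m with rfl | hm
  · simp [toArithmeticFunction]
  rcases Nat.eq_zero_or_pos n with rfl | hn
  · simp [toArithmeticFunction]
  rw [toArithmeticFunction_apply_ne_zero (by positivity), toArithmeticFunction_apply_ne_zero (by omega), toArithmeticFunction_apply_ne_zero (by omega)]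
  exact hcm m n hm hn

/-- The extension of an `S¹`-valued function is `1`-bounded. [folklore] -/
theorem norm_toArithmeticFunction_le_one {g : ℕ → ℂ} (hS : ∀ n : ℕ, 1 ≤ n → ‖g n‖ = 1) (n : ℕ) :
    ‖toArithmeticFunction g n‖ ≤ 1 := by
  rcases Nat.eq_zero_or_pos n with rfl | hn
  · simp [toArithmeticFunction]
  · rw [toArithmeticFunction_apply_ne_zero (by omega), hS n hn]

/-- Short exponential sums only involve positive arguments. [folklore] -/
theorem shortExpSum_toArithmeticFunction (g : ℕ → ℂ) (n H : ℕ) (α : ℝ) :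
    shortExpSum (toArithmeticFunction g) n H α = shortExpSum g n H α := by
  unfold shortExpSum
  refine Finset.sum_congr rfl fun j hj => ?_
  rw [toArithmeticFunction_apply_ne_zero]
  have := (Finset.mem_Icc.mp hj).1
  omega

/-- Pretentious distances only involve prime arguments. [folklore] -/
theorem pretentiousDistSq_toArithmeticFunction (g z : ℕ → ℂ) (x : ℝ) :
    Sieve.pretentiousDistSq (toArithmeticFunction g) z x = Sieve.pretentiousDistSq g z x := by
  unfold Sieve.pretentiousDistSq
  refine Finset.sum_congr rfl fun p hp => ?_
  rw [toArithmeticFunction_apply_ne_zero (Nat.prime_of_mem_primesLE hp).ne_zero]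

/-- **The Matomäki–Radziwiłł–Tao bound for sums over integers**: for integers `N ≥ H ≥ 10` and a
completely multiplicative `S¹`-valued `g`,
`∑_{n < N} |∑_{j=1}^H g(n+j) e(jα)| ≤ C₀ (e^{-M/20} + log log H/log H + log^{-1/700} N) H N` with
`M = M(g; N, min(log^{1/125} N, log⁵ H))`. [cite: MatomakiRadziwillTao2015, Theorem 1.7] -/
theorem sum_norm_shortExpSum_le {C₀ : ℝ}
    (hMRT : ∀ g : ArithmeticFunction ℂ, g.IsMultiplicative → (∀ n, ‖g n‖ ≤ 1) →
      ∀ X H : ℝ, 10 ≤ H → H ≤ X → ∀ α : ℝ,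
        ∫ x in (0 : ℝ)..X,
            ‖∑ n ∈ Icc ⌈x⌉₊ ⌊x + H⌋₊,
                g n * Complex.exp (2 * Real.pi * Complex.I * (α : ℂ) * (n : ℂ))‖
          ≤ C₀ * (Real.exp (-(Sieve.nonpretentiousness g X
                  (min (Real.log X ^ (1 / 125 : ℝ)) (Real.log H ^ (5 : ℝ)))) / 20)
                + Real.log (Real.log H) / Real.log H + 1 / Real.log X ^ (1 / 700 : ℝ)) * H * X)
    {g : ℕ → ℂ} (hcm : ∀ m n : ℕ, 1 ≤ m → 1 ≤ n → g (m * n) = g m * g n)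
    (hS : ∀ n : ℕ, 1 ≤ n → ‖g n‖ = 1) {N H : ℕ} (hH : 10 ≤ H) (hHN : H ≤ N) (α : ℝ) :
    ∑ n ∈ Finset.range N, ‖shortExpSum g n H α‖
      ≤ C₀ * (Real.exp (-(Sieve.nonpretentiousness (toArithmeticFunction g) N
              (min (Real.log N ^ (1 / 125 : ℝ)) (Real.log H ^ (5 : ℝ)))) / 20)
            + Real.log (Real.log H) / Real.log H + 1 / Real.log N ^ (1 / 700 : ℝ)) * H * N := by
  have h := hMRT (toArithmeticFunction g) (isMultiplicative_toArithmeticFunction hcm hS) (norm_toArithmeticFunction_le_one hS)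
    (N : ℝ) (H : ℝ) (by exact_mod_cast hH) (by exact_mod_cast hHN) α
  have heq : ∑ n ∈ Finset.range N, ‖shortExpSum g n H α‖
      = ∫ y in (0 : ℝ)..(N : ℝ), mrtIntegrand (toArithmeticFunction g) H α y := by
    rw [← sum_norm_shortExpSum_eq_integral]
    simp only [shortExpSum_toArithmeticFunction]
  rw [heq]
  exact h

/-! ### Lower bounds for `M(g; X, Q)` and the change of height -/

/-- A pointwise lower bound for all the twisted distances gives a lower bound for the infimum
`M(g; X, Q) = Literature.nonpretentiousness g X Q` (`X ≥ 0`, `Q ≥ 1`). [folklore] -/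
theorem le_nonpretentiousness {g : ℕ → ℂ} {X Q B : ℝ} (hX : 0 ≤ X) (hQ : 1 ≤ Q)
    (h : ∀ (q : ℕ) (χ : DirichletCharacter ℂ q) (t : ℝ), 1 ≤ q → (q : ℝ) ≤ Q → |t| ≤ X →
      B ≤ Sieve.pretentiousDistSq g (Sieve.twistedChar χ t) X) :
    B ≤ Sieve.nonpretentiousness g X Q := by
  unfold Sieve.nonpretentiousness
  have hQ1 : 1 ≤ ⌊Q⌋₊ := Nat.le_floor (by exact_mod_cast hQ)
  have : Nonempty (Set.Icc 1 ⌊Q⌋₊) := ⟨⟨1, le_rfl, hQ1⟩⟩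
  refine le_ciInf fun q => ?_
  have : Nonempty (DirichletCharacter ℂ (q : ℕ)) := ⟨1⟩
  refine le_ciInf fun χ => ?_
  unfold Sieve.charNonpretentiousness
  have : Nonempty (Set.Icc (-X) X) := ⟨⟨0, by simp [hX]⟩⟩
  refine le_ciInf fun t => ?_
  have hq := q.2
  rw [Set.mem_Icc] at hq
  have hqQ : ((q : ℕ) : ℝ) ≤ Q := le_trans (by exact_mod_cast hq.2) (Nat.floor_le (by linarith))
  have ht := t.2
  rw [Set.mem_Icc] at ht
  exact h q χ t hq.1 hqQ (abs_le.mpr ⟨ht.1, ht.2⟩)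

/-- **Mertens-type window bound (Chebyshev strength)**: for `4 ≤ y ≤ x` with `log x ≤ K log y`
(`K ≥ 1`), `∑_{⌊y⌋ < p ≤ ⌊x⌋} 1/p ≤ 8K + 8` (from the dyadic bound of `PrimeReciprocalWindows`).
The real-variable bookkeeping repeats that of `Literature.NumberTheory.LFunctions.Tao2016.modulusDist_window`
(`TaoLogElliottUnimodular.lean`), which is this estimate applied to `D(g; ·)`; a later pass could
derive the latter from the present lemma. [folklore] -/
theorem sum_invPrimeWeight_window_le {x y K : ℝ} (hy : 4 ≤ y) (hxy : y ≤ x) (hK : 1 ≤ K)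
    (hlog : Real.log x ≤ K * Real.log y) :
    ∑ p ∈ Ioc ⌊y⌋₊ ⌊x⌋₊, PrimeReciprocal.invPrimeWeight p ≤ 8 * K + 8 := by
  set a : ℕ := Nat.log 2 ⌊y⌋₊ with ha
  set b : ℕ := Nat.log 2 ⌊x⌋₊ + 1 with hb'
  have hy4 : 4 ≤ ⌊y⌋₊ := Nat.le_floor (by exact_mod_cast hy)
  have hyne : ⌊y⌋₊ ≠ 0 := by omega
  have hx4 : 4 ≤ ⌊x⌋₊ := Nat.le_floor (by exact_mod_cast (hy.trans hxy))
  have hxne : ⌊x⌋₊ ≠ 0 := by omega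
  have ha2 : 2 ≤ a := Nat.le_log_of_pow_le one_lt_two (by simpa using hy4)
  have h2a : 2 ^ a ≤ ⌊y⌋₊ := Nat.pow_log_le_self 2 hyne
  have h2b : ⌊x⌋₊ < 2 ^ b := Nat.lt_pow_succ_log_self one_lt_two _
  have h2a' : ⌊y⌋₊ < 2 ^ (a + 1) := Nat.lt_pow_succ_log_self one_lt_two _
  have h2b' : 2 ^ (b - 1) ≤ ⌊x⌋₊ := by
    rw [hb', Nat.add_sub_cancel]; exact Nat.pow_log_le_self 2 hxne
  have hab : a ≤ b := by
    have h3 : 2 ^ a < 2 ^ b := lt_of_le_of_lt (h2a.trans (Nat.floor_le_floor hxy)) h2b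
    exact ((Nat.pow_lt_pow_iff_right (by norm_num)).mp h3).le
  have h1 : ∑ p ∈ Ioc ⌊y⌋₊ ⌊x⌋₊, PrimeReciprocal.invPrimeWeight p ≤ 4 * ((b : ℝ) - a) / a := by
    refine le_trans ?_ (PrimeReciprocal.sum_Ioc_pow_invPrimeWeight_le (by omega) hab)
    refine Finset.sum_le_sum_of_subset_of_nonneg (fun p hp => ?_)
      fun p _ _ => PrimeReciprocal.invPrimeWeight_nonneg p
    rw [Finset.mem_Ioc] at hp ⊢
    exact ⟨lt_of_le_of_lt h2a hp.1, hp.2.trans h2b.le⟩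
  have hL : 0 < Real.log 2 := Real.log_pos one_lt_two
  have hypos : 0 < y := by linarith
  have hlogy : Real.log y < (a + 1) * Real.log 2 := by
    have h3 : y < (2 : ℝ) ^ (a + 1) := by
      calc y < ⌊y⌋₊ + 1 := Nat.lt_floor_add_one y
        _ ≤ (2 : ℝ) ^ (a + 1) := by exact_mod_cast h2a'
    have h4 := Real.log_lt_log hypos h3
    rw [Real.log_pow] at h4
    push_cast at h4
    exact h4
  have hlogx : ((b : ℝ) - 1) * Real.log 2 ≤ Real.log x := by
    have h3 : (2 : ℝ) ^ (b - 1) ≤ x := by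
      calc (2 : ℝ) ^ (b - 1) ≤ ⌊x⌋₊ := by exact_mod_cast h2b'
        _ ≤ x := Nat.floor_le (by linarith)
    have h4 := Real.log_le_log (by positivity) h3
    rw [Real.log_pow, Nat.cast_sub (by omega : 1 ≤ b)] at h4
    simpa using h4
  have ha2r : (2 : ℝ) ≤ a := by exact_mod_cast ha2
  have hba : (b : ℝ) - 1 ≤ K * (a + 1) := by
    have h4 : ((b : ℝ) - 1) * Real.log 2 ≤ (K * (a + 1)) * Real.log 2 := by
      calc ((b : ℝ) - 1) * Real.log 2 ≤ Real.log x := hlogx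
        _ ≤ K * Real.log y := hlog
        _ ≤ K * ((a + 1) * Real.log 2) := mul_le_mul_of_nonneg_left hlogy.le (by linarith)
        _ = (K * (a + 1)) * Real.log 2 := by ring
    exact le_of_mul_le_mul_right h4 hL
  have ha0 : (0 : ℝ) < a := by linarith
  refine h1.trans ?_
  rw [div_le_iff₀ ha0]
  nlinarith

/-- **Change of height for twisted distances**: for `1`-bounded `f, z` and `4 ≤ y ≤ x` with
`log x ≤ K log y`, `𝔻(f, z; y)² ≥ 𝔻(f, z; x)² - (16K + 16)` (each prime `⌊y⌋ < p ≤ ⌊x⌋`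
contributes at most `2/p`). [folklore] -/
theorem pretentiousDistSq_window {f z : ℕ → ℂ} (hf : ∀ n, ‖f n‖ ≤ 1) (hz : ∀ n, ‖z n‖ ≤ 1)
    {x y K : ℝ} (hy : 4 ≤ y) (hxy : y ≤ x) (hK : 1 ≤ K) (hlog : Real.log x ≤ K * Real.log y) :
    Sieve.pretentiousDistSq f z x - Sieve.pretentiousDistSq f z y ≤ 16 * K + 16 := by
  have hsub : Nat.primesLE ⌊y⌋₊ ⊆ Nat.primesLE ⌊x⌋₊ := by
    intro p hp
    rw [Nat.mem_primesLE] at hp ⊢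
    exact ⟨hp.1.trans (Nat.floor_le_floor hxy), hp.2⟩
  unfold Sieve.pretentiousDistSq
  rw [← Finset.sum_sdiff hsub, add_sub_cancel_right]
  have hterm : ∀ p ∈ Nat.primesLE ⌊x⌋₊ \ Nat.primesLE ⌊y⌋₊,
      (1 - (f p * (starRingEnd ℂ) (z p)).re) / (p : ℝ) ≤ 2 * PrimeReciprocal.invPrimeWeight p := by
    intro p hp
    have hp' := Nat.prime_of_mem_primesLE (Finset.mem_sdiff.mp hp).1
    rw [PrimeReciprocal.invPrimeWeight_of_prime hp', mul_one_div]
    refine div_le_div_of_nonneg_right ?_ (Nat.cast_nonneg p)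
    have h1 : |(f p * (starRingEnd ℂ) (z p)).re| ≤ 1 := by
      calc |(f p * (starRingEnd ℂ) (z p)).re| ≤ ‖f p * (starRingEnd ℂ) (z p)‖ :=
            Complex.abs_re_le_norm _
        _ = ‖f p‖ * ‖z p‖ := by rw [norm_mul, Complex.norm_conj]
        _ ≤ 1 * 1 := mul_le_mul (hf p) (hz p) (norm_nonneg _) zero_le_one
        _ = 1 := one_mul 1
    have := neg_le_of_abs_le h1
    linarith
  calc ∑ p ∈ Nat.primesLE ⌊x⌋₊ \ Nat.primesLE ⌊y⌋₊, (1 - (f p * (starRingEnd ℂ) (z p)).re) / (p : ℝ)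
      ≤ ∑ p ∈ Nat.primesLE ⌊x⌋₊ \ Nat.primesLE ⌊y⌋₊, 2 * PrimeReciprocal.invPrimeWeight p :=
        Finset.sum_le_sum hterm
    _ ≤ ∑ p ∈ Ioc ⌊y⌋₊ ⌊x⌋₊, 2 * PrimeReciprocal.invPrimeWeight p := by
        refine Finset.sum_le_sum_of_subset_of_nonneg (fun p hp => ?_)
          fun p _ _ => mul_nonneg zero_le_two (PrimeReciprocal.invPrimeWeight_nonneg p)
        obtain ⟨h1, h2⟩ := Finset.mem_sdiff.mp hp
        rw [Nat.mem_primesLE] at h1 h2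
        rw [Finset.mem_Ioc]
        refine ⟨?_, h1.1⟩
        by_contra h
        exact h2 ⟨by omega, h1.2⟩
    _ = 2 * ∑ p ∈ Ioc ⌊y⌋₊ ⌊x⌋₊, PrimeReciprocal.invPrimeWeight p := by rw [Finset.mul_sum]
    _ ≤ 2 * (8 * K + 8) :=
        mul_le_mul_of_nonneg_left (sum_invPrimeWeight_window_le hy hxy hK hlog) zero_le_two
    _ = 16 * K + 16 := by ring

/-- **Hypothesis (2.7) at a lower height.**  If `𝔻(g, χ(n)n^{it}; x)² ≥ A` for `q ≤ A`,
`|t| ≤ A x`, then for `4 ≤ X`, `x^θ ≤ X ≤ 3x` (`0 < θ ≤ 1`), `A ≥ 3`, `x ≥ 1`, every `q ≤ A` and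
`|t| ≤ X` give `𝔻(g, χ(n)n^{it}; X)² ≥ A - (16/θ + 16)` (monotonicity if `X ≥ x`, the window
bound if `X < x`). [cite: TaoFMP2016, proof of Proposition 2.4] -/
theorem pretentiousDistSq_at_height {g : ℕ → ℂ} (hb : ∀ n, ‖g n‖ ≤ 1) {A x X θ : ℝ}
    (hA3 : 3 ≤ A) (hx1 : 1 ≤ x) (hθ : 0 < θ) (hθ1 : θ ≤ 1) (hX4 : 4 ≤ X) (hXθ : x ^ θ ≤ X)
    (hX2 : X ≤ 3 * x)
    (hhyp : ∀ (q : ℕ) (χ : DirichletCharacter ℂ q) (t : ℝ), 1 ≤ q → (q : ℝ) ≤ A → |t| ≤ A * x →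
      A ≤ Sieve.pretentiousDistSq g (Sieve.twistedChar χ t) x)
    {q : ℕ} (χ : DirichletCharacter ℂ q) {t : ℝ} (hq : 1 ≤ q) (hqA : (q : ℝ) ≤ A) (ht : |t| ≤ X) :
    A - (16 / θ + 16) ≤ Sieve.pretentiousDistSq g (Sieve.twistedChar χ t) X := by
  have hxpos : 0 < x := by linarith
  have htx : |t| ≤ A * x := by nlinarith
  have h1 := hhyp q χ t hq hqA htx
  have hz : ∀ n, ‖Sieve.twistedChar χ t n‖ ≤ 1 := Sieve.norm_twistedChar_le_one χ t
  have h16 : 0 ≤ 16 / θ + 16 := by positivity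
  rcases le_or_gt x X with hxX | hxX
  · have := Sieve.pretentiousDistSq_mono hb hz hxX
    linarith
  · have hK : 1 ≤ 1 / θ := by rw [le_div_iff₀ hθ]; linarith
    have hlog : Real.log x ≤ 1 / θ * Real.log X := by
      have hX0 : 0 < X := by linarith
      have h2 : θ * Real.log x ≤ Real.log X := by
        rw [← Real.log_rpow hxpos]
        exact Real.log_le_log (Real.rpow_pos_of_pos hxpos θ) hXθ
      calc Real.log x = 1 / θ * (θ * Real.log x) := by field_simp
        _ ≤ 1 / θ * Real.log X := mul_le_mul_of_nonneg_left h2 (by positivity)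
    have hw := pretentiousDistSq_window hb hz hX4 hxX.le hK hlog
    have : 16 * (1 / θ) + 16 = 16 / θ + 16 := by ring
    linarith

/-! ### The function `ℓ(H) = log log H / log H` -/

/-- `ℓ(H) := log log H / log H`, the saving in (2.10). [cite: TaoFMP2016, (2.10)] -/
noncomputable def ell (H : ℝ) : ℝ := Real.log (Real.log H) / Real.log H

/-- `log 16 > e`, so that `log H ≥ e` for `H ≥ 16`. [folklore] -/
theorem exp_one_lt_log_sixteen : Real.exp 1 < Real.log 16 := by
  have h1 : Real.log 16 = 4 * Real.log 2 := by
    rw [show (16 : ℝ) = 2 ^ 4 by norm_num, Real.log_pow]; norm_num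
  rw [h1]
  have := Real.log_two_gt_d9
  have := Real.exp_one_lt_d9
  linarith

/-- `0 < ℓ(H)` for `H ≥ 16`. [folklore] -/
theorem ell_pos {H : ℝ} (hH : 16 ≤ H) : 0 < ell H := by
  have hlog : Real.exp 1 < Real.log H :=
    lt_of_lt_of_le exp_one_lt_log_sixteen (Real.log_le_log (by norm_num) hH)
  have h1 : 1 < Real.log H := lt_trans (by linarith [Real.add_one_le_exp (1 : ℝ)]) hlog
  exact div_pos (Real.log_pos h1) (by linarith)

/-- `ℓ(H) ≤ 1` for `H ≥ 16`. [folklore] -/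
theorem ell_le_one {H : ℝ} (hH : 16 ≤ H) : ell H ≤ 1 := by
  have hlog : Real.exp 1 < Real.log H :=
    lt_of_lt_of_le exp_one_lt_log_sixteen (Real.log_le_log (by norm_num) hH)
  have hpos : 0 < Real.log H := lt_trans (Real.exp_pos 1) hlog
  unfold ell
  rw [div_le_one hpos]
  linarith [Real.log_le_sub_one_of_pos hpos]

/-- `ℓ` is non-increasing on `[16, ∞)` (`log u / u` decreases for `u ≥ e`). [folklore] -/
theorem ell_antitone {H H' : ℝ} (hH : 16 ≤ H) (hHH' : H ≤ H') : ell H' ≤ ell H := by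
  have h1 : Real.exp 1 ≤ Real.log H :=
    (lt_of_lt_of_le exp_one_lt_log_sixteen (Real.log_le_log (by norm_num) hH)).le
  have h2 : Real.log H ≤ Real.log H' := Real.log_le_log (by linarith) hHH'
  exact Real.log_div_self_antitoneOn h1 (h1.trans h2) h2

/-- `e^{-u} ≤ 1/u` for `u > 0`. [folklore] -/
theorem exp_neg_le_inv {u : ℝ} (hu : 0 < u) : Real.exp (-u) ≤ 1 / u := by
  rw [Real.exp_neg, ← one_div, div_le_div_iff_of_pos_left one_pos (Real.exp_pos u) hu]
  linarith [Real.add_one_le_exp u]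

/-- `|∑_{j=1}^H g(n+j) e(jα)| ≤ H` for `S¹`-valued `g`. [folklore] -/
theorem norm_shortExpSum_le {g : ℕ → ℂ} (hS : ∀ n : ℕ, 1 ≤ n → ‖g n‖ = 1) (n H : ℕ) (α : ℝ) :
    ‖shortExpSum g n H α‖ ≤ H := by
  unfold shortExpSum
  refine (norm_sum_le _ _).trans ?_
  have h : ∀ j ∈ Icc 1 H, ‖g (n + j) * Complex.exp (2 * Real.pi * Complex.I * (j : ℂ) * (α : ℂ))‖ = 1 := by
    intro j hj
    have hj1 := (Finset.mem_Icc.mp hj).1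
    rw [norm_mul, hS (n + j) (by omega), one_mul, Complex.norm_exp]
    simp
  rw [Finset.sum_congr rfl h]
  simp

/-! ### Proposition 2.4 from Matomäki–Radziwiłł–Tao -/

end Tao2016

open Tao2016

set_option maxHeartbeats 800000 in
/-- **Tao 2016, Proposition 2.4, PROVED from Matomäki–Radziwiłł–Tao 2015, Theorem 1.7.**
Constants: `C = 48 C₀ + 2` (`C₀ ≥ 1` the MRT constant), `H₀ = 16`; for given `H₊` put
`T = max(H₊, 16)`, `ℓ₊ = ℓ(T)`, `θ = ℓ₊/64`, and take `A ≥ max(3, e^T, log⁵ T, 2048/ℓ₊ + 32, 40/ℓ₊,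
exp(64 ℓ₊^{-701}), exp(6/ℓ₊))`.  Proof: `∑_{n < N} |∑_{j ≤ H} g₁(n+j)e(jα)| = ∫_0^N` (MRT integrand)
`≤ C₀(e^{-M/20} + ℓ(H) + log^{-1/700} N) H N` for `N ≥ H`; for `N ≥ x^θ` the height change costs
`16/θ + 16 ≤ A/2` in hypothesis (2.7) (`q ≤ log⁵ H ≤ A`, `|t| ≤ N ≤ 3x ≤ Ax`), so `M ≥ A/2` and
the bracket is `≤ 3ℓ(H)`; the dyadic decomposition of `(x/ω, x]` above `max(8, x^θ, T)`
(`Tao2016.sum_norm_div_high_le`, `card_blocks_le`) and the trivial bound below it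
(`sum_inv_low_le`, costing `6 + (ℓ₊/32) log ω`) conclude.
[cite: TaoFMP2016, Proposition 2.4 (proof)] -/
theorem Tao2016_prop24_of_MRT (hMRT : MatomakiRadziwillTao2015_theorem17) : Tao2016_prop24 := by
  obtain ⟨C₀', hMRT'⟩ := hMRT
  set C₀ : ℝ := max C₀' 1 with hC₀def
  have hC₀ : 1 ≤ C₀ := le_max_right _ _
  have hC₀' : C₀' ≤ C₀ := le_max_left _ _
  refine ⟨48 * C₀ + 2, 16, fun Hplus => ?_⟩
  -- parameters depending on `H₊`
  set T : ℕ := max Hplus 16 with hTdef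
  have hT16 : (16 : ℝ) ≤ T := by exact_mod_cast le_max_right Hplus 16
  set ℓp : ℝ := ell T with hℓpdef
  have hℓp : 0 < ℓp := ell_pos hT16
  have hℓp1 : ℓp ≤ 1 := ell_le_one hT16
  set θ : ℝ := ℓp / 64 with hθdef
  have hθ : 0 < θ := by positivity
  have hθ1 : θ ≤ 1 := by rw [hθdef]; linarith
  have hθ2 : θ ≤ 1 / 2 := by rw [hθdef]; linarith
  refine ⟨max (max (max 3 (Real.exp T)) (max (Real.log T ^ 5) (2048 / ℓp + 32)))
    (max (max (40 / ℓp) (Real.exp (64 * (1 / ℓp) ^ 701))) (Real.exp (6 / ℓp))), ?_⟩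
  intro A hA x ω hAω hωx hωx' g₁ hcm hS hhyp H hH16 hHH α
  -- unpacking the size of `A`
  rw [max_le_iff, max_le_iff, max_le_iff, max_le_iff, max_le_iff, max_le_iff] at hA
  obtain ⟨⟨⟨hA3, hAT⟩, hAlog5, hA2048⟩, ⟨hA40, hA701⟩, hA6⟩ := hA
  -- basic sizes
  have hT16N : 16 ≤ T := le_max_right Hplus 16
  have hApos : 0 < A := by linarith
  have hω1 : 1 ≤ ω := by linarith
  have hωpos : 0 < ω := by linarith
  have hx1 : 1 ≤ x := hω1.trans hωx'
  have hxpos : 0 < x := by linarith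
  have hlogA : (T : ℝ) ≤ Real.log A := by
    rw [← Real.log_exp T]; exact Real.log_le_log (Real.exp_pos _) hAT
  have hlogω : Real.log A ≤ Real.log ω := Real.log_le_log hApos hAω
  have hlogωx : Real.log ω ≤ Real.log x := Real.log_le_log hωpos hωx'
  have hlogx16 : 16 ≤ Real.log x := by linarith
  have hlogxpos : 0 < Real.log x := by linarith
  have hlogω1 : 1 ≤ Real.log ω := by linarith
  have hlogω0 : 0 ≤ Real.log ω := by linarith
  have hxT : (T : ℝ) ≤ x := by
    have : Real.log x ≤ x := by linarith [Real.log_le_sub_one_of_pos hxpos]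
    linarith
  have hxω : Real.log x ≤ x / ω := by
    -- from `ω ≤ x / log x`
    rw [le_div_iff₀ hωpos]
    have := mul_le_mul_of_nonneg_right hωx hlogxpos.le
    rwa [div_mul_cancel₀ _ hlogxpos.ne', mul_comm] at this
  -- `H`
  have hHT : H ≤ T := hHH.trans (le_max_left _ _)
  have hH16r : (16 : ℝ) ≤ H := by exact_mod_cast hH16
  have hHTr : (H : ℝ) ≤ T := by exact_mod_cast hHT
  have hH10 : 10 ≤ H := le_trans (by norm_num) hH16
  set ℓ : ℝ := Real.log (Real.log H) / Real.log H with hℓdef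
  have hℓell : ℓ = ell H := rfl
  have hℓp_le : ℓp ≤ ℓ := by rw [hℓell, hℓpdef]; exact ell_antitone hH16r hHTr
  have hℓpos : 0 < ℓ := lt_of_lt_of_le hℓp hℓp_le
  have hℓ1 : ℓ ≤ 1 := by rw [hℓell]; exact ell_le_one hH16r
  have hlogH : Real.exp 1 < Real.log H :=
    lt_of_lt_of_le exp_one_lt_log_sixteen (Real.log_le_log (by norm_num) hH16r)
  have hlogHpos : 0 < Real.log H := lt_trans (Real.exp_pos 1) hlogH
  -- the extension `g` of `g₁` and its hypothesis (2.7)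
  set g : ArithmeticFunction ℂ := toArithmeticFunction g₁ with hgdef
  have hgb : ∀ n, ‖g n‖ ≤ 1 := norm_toArithmeticFunction_le_one hS
  have hhyp' : ∀ (q : ℕ) (χ : DirichletCharacter ℂ q) (t : ℝ), 1 ≤ q → (q : ℝ) ≤ A →
      |t| ≤ A * x → A ≤ Sieve.pretentiousDistSq g (Sieve.twistedChar χ t) x := by
    intro q χ t hq hqA ht
    rw [hgdef, pretentiousDistSq_toArithmeticFunction]
    exact hhyp q χ t hq hqA ht
  -- the truncated normalised short sums as an arithmetic function `c`
  set U : ℕ := ⌊x⌋₊ with hUdef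
  set L : ℕ := ⌊x / ω⌋₊ with hLdef
  have hUT : T ≤ U := Nat.le_floor hxT
  have hLU : L ≤ U := Nat.floor_le_floor (div_le_self hxpos.le hω1)
  set cf : ℕ → ℝ := fun m => if m ≤ 2 * U + 2 then ‖shortExpSum g₁ m H α‖ / H else 0 with hcfdef
  have hHpos : (0 : ℝ) < H := by linarith
  have hcf0 : ∀ m, 0 ≤ cf m := by
    intro m; simp only [hcfdef]; split_ifs
    · positivity
    · exact le_rfl
  have hcf1 : ∀ m, cf m ≤ 1 := by
    intro m; simp only [hcfdef]; split_ifs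
    · rw [div_le_one hHpos]; exact norm_shortExpSum_le hS m H α
    · exact zero_le_one
  set c : ArithmeticFunction ℂ := ⟨fun m => if m = 0 then 0 else ((cf m : ℝ) : ℂ), by simp⟩
    with hcdef
  have hc_apply : ∀ m, 1 ≤ m → ‖c m‖ = cf m := by
    intro m hm
    have : c m = ((cf m : ℝ) : ℂ) := by simp [hcdef, show m ≠ 0 by omega]
    rw [this, Complex.norm_real, Real.norm_of_nonneg (hcf0 m)]
  have hc1 : ∀ m, ‖c m‖ ≤ 1 := by
    intro m
    rcases Nat.eq_zero_or_pos m with rfl | hm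
    · simp [hcdef]
    · rw [hc_apply m hm]; exact hcf1 m
  -- the left-hand side in terms of `c`
  have hLHS : logAvgShortExpSum g₁ x ω H α = ∑ n ∈ Ioc L U, ‖c (1 * n + 0)‖ / (n : ℝ) := by
    unfold logAvgShortExpSum
    refine Finset.sum_congr rfl fun n hn => ?_
    have hn := Finset.mem_Ioc.mp hn
    have hn1 : 1 ≤ n := by omega
    rw [one_mul, add_zero, hc_apply n hn1]
    simp only [hcfdef, if_pos (show n ≤ 2 * U + 2 by omega)]
    rw [div_div]
  -- the mean value bound for `c` on `[Y₁, ∞)`, `Y₁ = max (max 8 x^θ) T`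
  set Y₁ : ℝ := max (max 8 (x ^ θ)) T with hY₁def
  have hxθ1 : 1 ≤ x ^ θ := Real.one_le_rpow hx1 hθ.le
  have hxθx : x ^ θ ≤ x := by
    calc x ^ θ ≤ x ^ (1 : ℝ) := Real.rpow_le_rpow_of_exponent_le hx1 hθ1
      _ = x := Real.rpow_one x
  set η : ℝ := 6 * C₀ * ℓ with hηdef
  have hη0 : 0 ≤ η := by positivity
  have hY₁8 : (8 : ℝ) ≤ Y₁ := by
    rw [hY₁def]; exact le_max_of_le_left (le_max_left _ _)
  have hY₁θ : x ^ θ ≤ Y₁ := by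
    rw [hY₁def]; exact le_max_of_le_left (le_max_right _ _)
  have hY₁T : (T : ℝ) ≤ Y₁ := by
    rw [hY₁def]; exact le_max_right _ _
  have hMV : ∀ y : ℝ, Y₁ ≤ y → ∑ m ∈ Icc 1 ⌊y⌋₊, ‖c m‖ ≤ η * y := by
    intro y hy
    have hy8 : 8 ≤ y := hY₁8.trans hy
    have hyθ : x ^ θ ≤ y := hY₁θ.trans hy
    have hyT : (T : ℝ) ≤ y := hY₁T.trans hy
    have hypos : 0 < y := by linarith
    -- truncation: only `m ≤ N₀ := min ⌊y⌋ (2U+2)` contribute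
    set N₀ : ℕ := min ⌊y⌋₊ (2 * U + 2) with hN₀def
    set N : ℕ := N₀ + 1 with hNdef
    have hN₀y : N₀ ≤ ⌊y⌋₊ := min_le_left _ _
    have hN₀U : N₀ ≤ 2 * U + 2 := min_le_right _ _
    have hTy : T ≤ ⌊y⌋₊ := Nat.le_floor hyT
    have hTN₀ : T ≤ N₀ := le_min hTy (by omega)
    have hHN : H ≤ N := by omega
    have hN16 : (16 : ℝ) ≤ N := by exact_mod_cast (show 16 ≤ N by omega)
    have hNpos : (0 : ℝ) < N := by linarith
    have h1 : ∑ m ∈ Icc 1 ⌊y⌋₊, ‖c m‖ = ∑ m ∈ Icc 1 N₀, cf m := by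
      rw [← Finset.sum_subset (Finset.Icc_subset_Icc_right hN₀y)]
      · exact Finset.sum_congr rfl fun m hm => hc_apply m (Finset.mem_Icc.mp hm).1
      · intro m hm hm'
        rw [Finset.mem_Icc] at hm hm'
        rw [hc_apply m hm.1]
        simp only [hcfdef]
        rw [if_neg]
        omega
    have h2 : ∑ m ∈ Icc 1 N₀, cf m ≤ ∑ m ∈ Finset.range N, ‖shortExpSum g₁ m H α‖ / H := by
      calc ∑ m ∈ Icc 1 N₀, cf m ≤ ∑ m ∈ Icc 1 N₀, ‖shortExpSum g₁ m H α‖ / H := by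
            refine Finset.sum_le_sum fun m _ => ?_
            simp only [hcfdef]; split_ifs
            · exact le_rfl
            · positivity
        _ ≤ ∑ m ∈ Finset.range N, ‖shortExpSum g₁ m H α‖ / H := by
            refine Finset.sum_le_sum_of_subset_of_nonneg (fun m hm => ?_) fun _ _ _ => by positivity
            rw [Finset.mem_Icc] at hm; rw [Finset.mem_range]; omega
    -- MRT
    have hMRTN := sum_norm_shortExpSum_le hMRT' hcm hS hH10 hHN α
    set M : ℝ := Sieve.nonpretentiousness (toArithmeticFunction g₁) N
      (min (Real.log N ^ (1 / 125 : ℝ)) (Real.log H ^ (5 : ℝ))) with hMdef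
    set B : ℝ := Real.exp (-M / 20) + Real.log (Real.log H) / Real.log H
      + 1 / Real.log N ^ (1 / 700 : ℝ) with hBdef
    -- sizes of `N`
    have hNy : (N : ℝ) ≤ y + 1 := by
      have : (N₀ : ℝ) ≤ ⌊y⌋₊ := by exact_mod_cast hN₀y
      have h3 : (⌊y⌋₊ : ℝ) ≤ y := Nat.floor_le hypos.le
      rw [hNdef]; push_cast; linarith
    have hN2y : (N : ℝ) ≤ 2 * y := by linarith
    have hNθ : x ^ θ ≤ N := by
      -- both `⌊y⌋ + 1 > y ≥ x^θ` and `2U + 3 > 2x ≥ x^θ`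
      rcases le_total ⌊y⌋₊ (2 * U + 2) with hc | hc
      · have : N₀ = ⌊y⌋₊ := min_eq_left hc
        rw [hNdef, this]; push_cast
        linarith [Nat.lt_floor_add_one y]
      · have : N₀ = 2 * U + 2 := min_eq_right hc
        rw [hNdef, this]; push_cast
        have : x < (U : ℝ) + 1 := Nat.lt_floor_add_one x
        linarith
    have hN3x : (N : ℝ) ≤ 3 * x := by
      have h3 : (N₀ : ℝ) ≤ 2 * U + 2 := by exact_mod_cast hN₀U
      have h4 : (U : ℝ) ≤ x := Nat.floor_le hxpos.le
      rw [hNdef]; push_cast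
      have : (16 : ℝ) ≤ T := hT16
      linarith
    have hN4 : (4 : ℝ) ≤ N := by linarith
    -- (i) `M ≥ A/2`
    have hQ1 : 1 ≤ min (Real.log N ^ (1 / 125 : ℝ)) (Real.log H ^ (5 : ℝ)) := by
      refine le_min ?_ ?_
      · refine Real.one_le_rpow ?_ (by norm_num)
        have : Real.exp 1 < Real.log N :=
          lt_of_lt_of_le exp_one_lt_log_sixteen (Real.log_le_log (by norm_num) hN16)
        linarith [Real.add_one_le_exp (1 : ℝ)]
      · exact Real.one_le_rpow (by linarith [Real.add_one_le_exp (1 : ℝ)]) (by norm_num)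
    have hQA : min (Real.log N ^ (1 / 125 : ℝ)) (Real.log H ^ (5 : ℝ)) ≤ A := by
      refine (min_le_right _ _).trans ?_
      calc Real.log H ^ (5 : ℝ) = Real.log H ^ (5 : ℕ) := by
            rw [← Real.rpow_natCast]; norm_num
        _ ≤ Real.log T ^ 5 :=
            pow_le_pow_left₀ hlogHpos.le (Real.log_le_log (by linarith) hHTr) 5
        _ ≤ A := hAlog5
    have hM : A / 2 ≤ M := by
      rw [hMdef]
      refine le_nonpretentiousness hNpos.le hQ1 fun q χ t hq hqQ ht => ?_
      have hqA : (q : ℝ) ≤ A := hqQ.trans hQA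
      have h := pretentiousDistSq_at_height hgb hA3 hx1 hθ hθ1 hN4 hNθ hN3x hhyp' χ hq hqA ht
      have h32 : 16 / θ + 16 ≤ A / 2 := by
        rw [hθdef]
        have : 16 / (ℓp / 64) = 1024 / ℓp := by field_simp; ring
        rw [this]
        have : 2048 / ℓp = 2 * (1024 / ℓp) := by ring
        linarith
      rw [hgdef] at h
      linarith
    -- (ii) the three terms of the bracket are `≤ ℓ`
    have hB1 : Real.exp (-M / 20) ≤ ℓ := by
      have h1 : Real.exp (-M / 20) ≤ Real.exp (-(A / 40)) := Real.exp_le_exp.mpr (by linarith)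
      have h2 : Real.exp (-(A / 40)) ≤ 1 / (A / 40) := exp_neg_le_inv (by linarith)
      have h3 : 1 / (A / 40) ≤ ℓp := by
        rw [div_le_iff₀ (by linarith)]
        have := (div_le_iff₀ hℓp).mp hA40
        linarith
      linarith
    have hB3 : 1 / Real.log N ^ (1 / 700 : ℝ) ≤ ℓ := by
      -- `log N ≥ θ log x ≥ θ log A ≥ ℓp^{-700}`
      have hlogN : θ * Real.log x ≤ Real.log N := by
        rw [← Real.log_rpow hxpos]
        exact Real.log_le_log (Real.rpow_pos_of_pos hxpos θ) hNθ
      have hlogA' : 64 * (1 / ℓp) ^ 701 ≤ Real.log A := by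
        rw [← Real.log_exp (64 * (1 / ℓp) ^ 701)]
        exact Real.log_le_log (Real.exp_pos _) hA701
      have hkey : (1 / ℓp) ^ (700 : ℕ) ≤ Real.log N := by
        have e : θ * (64 * (1 / ℓp) ^ 701) = (1 / ℓp) ^ (700 : ℕ) := by
          rw [hθdef, pow_succ]; field_simp
        calc (1 / ℓp) ^ (700 : ℕ) = θ * (64 * (1 / ℓp) ^ 701) := e.symm
          _ ≤ θ * Real.log A := mul_le_mul_of_nonneg_left hlogA' hθ.le
          _ ≤ θ * Real.log x := mul_le_mul_of_nonneg_left (hlogω.trans hlogωx) hθ.le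
          _ ≤ Real.log N := hlogN
      have hℓpinv : 0 < 1 / ℓp := by positivity
      have hroot : 1 / ℓp ≤ Real.log N ^ (1 / 700 : ℝ) := by
        have h1 : ((1 / ℓp) ^ (700 : ℕ)) ^ ((700 : ℕ)⁻¹ : ℝ) = 1 / ℓp :=
          Real.pow_rpow_inv_natCast hℓpinv.le (by norm_num)
        have h2 : ((1 / ℓp) ^ (700 : ℕ)) ^ ((700 : ℕ)⁻¹ : ℝ) ≤ Real.log N ^ ((700 : ℕ)⁻¹ : ℝ) :=
          Real.rpow_le_rpow (by positivity) hkey (by positivity)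
        rw [h1] at h2
        have h3 : ((700 : ℕ)⁻¹ : ℝ) = 1 / 700 := by norm_num
        rwa [h3] at h2
      have hpos : 0 < Real.log N ^ (1 / 700 : ℝ) := lt_of_lt_of_le hℓpinv hroot
      calc 1 / Real.log N ^ (1 / 700 : ℝ) ≤ 1 / (1 / ℓp) :=
            one_div_le_one_div_of_le hℓpinv hroot
        _ = ℓp := one_div_one_div ℓp
        _ ≤ ℓ := hℓp_le
    have hB : B ≤ 3 * ℓ := by rw [hBdef]; linarith
    have hB0 : 0 ≤ B := by rw [hBdef]; positivity
    -- assembling the mean value bound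
    have h3 : ∑ m ∈ Finset.range N, ‖shortExpSum g₁ m H α‖ ≤ C₀ * B * H * N := by
      have step : C₀' * B * H * N ≤ C₀ * B * H * N := by
        have s1 : C₀' * B ≤ C₀ * B := mul_le_mul_of_nonneg_right hC₀' hB0
        have s2 : C₀' * B * H ≤ C₀ * B * H := mul_le_mul_of_nonneg_right s1 hHpos.le
        exact mul_le_mul_of_nonneg_right s2 hNpos.le
      exact hMRTN.trans step
    calc ∑ m ∈ Icc 1 ⌊y⌋₊, ‖c m‖ = ∑ m ∈ Icc 1 N₀, cf m := h1
      _ ≤ ∑ m ∈ Finset.range N, ‖shortExpSum g₁ m H α‖ / H := h2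
      _ = (∑ m ∈ Finset.range N, ‖shortExpSum g₁ m H α‖) / H := by rw [Finset.sum_div]
      _ ≤ C₀ * B * H * N / H := div_le_div_of_nonneg_right h3 hHpos.le
      _ = C₀ * B * N := by field_simp
      _ ≤ C₀ * (3 * ℓ) * (2 * y) := by
          have : 0 ≤ C₀ := by linarith
          refine mul_le_mul (mul_le_mul_of_nonneg_left hB this) hN2y hNpos.le (by positivity)
      _ = η * y := by rw [hηdef]; ring
  -- split the left-hand side at `Y₁` and apply the dyadic bound above, the trivial bound below
  rw [hLHS, ← Finset.sum_filter_add_sum_filter_not _ (fun n : ℕ => Y₁ ≤ (n : ℝ))]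
  have hhigh := sum_norm_div_high_le c (le_refl 1) hη0 hMV hLU (b := 0)
  have hblocks := card_blocks_le hω1 hωx'
  have hhigh' : ∑ n ∈ (Ioc L U).filter (fun n : ℕ => Y₁ ≤ (n : ℝ)), ‖c (1 * n + 0)‖ / (n : ℝ)
      ≤ 4 * η * Real.log ω + 4 * η := by
    refine hhigh.trans ?_
    have hL2 : (1 : ℝ) / 2 ≤ Real.log 2 := by have := Real.log_two_gt_d9; linarith
    have hdiv : Real.log ω / Real.log 2 ≤ 2 * Real.log ω := by
      calc Real.log ω / Real.log 2 ≤ Real.log ω / (1 / 2) :=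
            div_le_div_of_nonneg_left hlogω0 (by norm_num) hL2
        _ = 2 * Real.log ω := by ring
    have e : η * (2 * (1 : ℕ) + (0 : ℕ)) = 2 * η := by push_cast; ring
    rw [e]
    calc ((Nat.log 2 U : ℝ) - Nat.log 2 L + 1) * (2 * η) ≤ (Real.log ω / Real.log 2 + 2) * (2 * η) :=
          mul_le_mul_of_nonneg_right hblocks (by positivity)
      _ ≤ (2 * Real.log ω + 2) * (2 * η) := mul_le_mul_of_nonneg_right (by linarith) (by positivity)
      _ = 4 * η * Real.log ω + 4 * η := by ring
  -- below `Y₁`: since `n > x/ω ≥ log x ≥ T`, the condition `¬ (Y₁ ≤ n)` is `¬ (max 8 x^θ ≤ n)`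
  have hlow' : ∑ n ∈ (Ioc L U).filter (fun n : ℕ => ¬ (Y₁ ≤ (n : ℝ))), ‖c (1 * n + 0)‖ / (n : ℝ)
      ≤ 6 + 2 * θ * Real.log ω := by
    have hfilt : (Ioc L U).filter (fun n : ℕ => ¬ (Y₁ ≤ (n : ℝ)))
        = (Ioc L U).filter (fun n : ℕ => ¬ (max 8 (x ^ θ) ≤ (n : ℝ))) := by
      refine Finset.filter_congr fun n hn => ?_
      have hn1 : L + 1 ≤ n := (Finset.mem_Ioc.mp hn).1
      have hnT : (T : ℝ) ≤ n := by
        have h1 : x / ω < (L : ℝ) + 1 := Nat.lt_floor_add_one _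
        have h2 : ((L + 1 : ℕ) : ℝ) ≤ n := by exact_mod_cast hn1
        push_cast at h2
        linarith
      rw [hY₁def, max_le_iff]
      tauto
    rw [hfilt]
    refine le_trans (Finset.sum_le_sum fun n hn => ?_) (sum_inv_low_le hω1 hωx' hθ hθ2)
    rw [← one_div]
    exact div_le_div_of_nonneg_right (hc1 _) (Nat.cast_nonneg n)
  -- final arithmetic: everything is `≤ (48 C₀ + 2) ℓ log ω`
  have h6 : 6 ≤ ℓ * Real.log ω := by
    have h1 : 6 / ℓp ≤ Real.log A := by
      rw [← Real.log_exp (6 / ℓp)]; exact Real.log_le_log (Real.exp_pos _) hA6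
    have h2 : 6 ≤ ℓp * Real.log ω := by
      have := (div_le_iff₀ hℓp).mp (h1.trans hlogω)
      linarith
    have h3 : ℓp * Real.log ω ≤ ℓ * Real.log ω := mul_le_mul_of_nonneg_right hℓp_le hlogω0
    linarith
  have hθℓ : 2 * θ * Real.log ω ≤ ℓ * Real.log ω := by
    have : 2 * θ ≤ ℓ := by rw [hθdef]; linarith
    exact mul_le_mul_of_nonneg_right this hlogω0
  have hηℓ : 4 * η ≤ 24 * C₀ * ℓ * Real.log ω := by
    have e : 4 * η = 24 * C₀ * ℓ := by rw [hηdef]; ring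
    rw [e]
    exact le_mul_of_one_le_right (by positivity) hlogω1
  have hηℓ' : 4 * η * Real.log ω = 24 * C₀ * ℓ * Real.log ω := by rw [hηdef]; ring
  calc _ ≤ (4 * η * Real.log ω + 4 * η) + (6 + 2 * θ * Real.log ω) := add_le_add hhigh' hlow'
    _ ≤ (48 * C₀ + 2) * ℓ * Real.log ω := by linarith
    _ = (48 * C₀ + 2) * (Real.log (Real.log H) / Real.log H) * Real.log ω := by rw [hℓdef]


/-- **Theorem 2.3 from Matomäki–Radziwiłł–Tao 2015 (Thm 1.7) and the core argument.**
[cite: TaoFMP2016, §2 (Proposition 2.4 and the remark following it)] -/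
theorem Tao2016_theorem23_of_MRT_core (hMRT : MatomakiRadziwillTao2015_theorem17)
    (hcore : Tao2016_theorem23_core) : Tao2016_theorem23 :=
  Tao2016_theorem23_of_parts (Tao2016_prop24_of_MRT hMRT) hcore

/-- **Theorem 1.3 from Matomäki–Radziwiłł–Tao 2015 (Thm 1.7) and the core argument**: with the §2
reduction proved (`Literature.NumberTheory.LFunctions.Tao2016_section2_reduction_holds`, `TaoLogElliottProp21.lean`),
`Literature.NumberTheory.LFunctions.tao_log_averaged_elliott_two` follows from the named facts
`MatomakiRadziwillTao2015_theorem17` and `Tao2016_theorem23_core`. [cite: TaoFMP2016, §2] -/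
theorem tao_log_averaged_elliott_two_of_MRT_core (hMRT : MatomakiRadziwillTao2015_theorem17)
    (hcore : Tao2016_theorem23_core) : tao_log_averaged_elliott_two :=
  Tao2016_section2_reduction_holds (Tao2016_theorem23_of_MRT_core hMRT hcore)

end Literature.NumberTheory.LFunctions
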